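import Summits.Ventures.PercRepro.SevenThreeCycClasses
import Summits.Ventures.PercRepro.SevenThreeStarCoeff

/-!
# PercRepro — the `(7,3)` cell: THE DENOMINATOR OF A NULLITY-TWO WITNESS IS THE STAR TABLE'S `DstarN` (p3, gen 16)

For a finset `S ⊆ E` of nullity two (`ρ(S) + 2 = |S|`, `5 ≤ |S|`) with cyclic part `K` and `lp` coloops, and a class
list `L` of `K` (`IsClassList`), `D(S) = DstarN lp (L.map card) (|S| − 3)` (`D_eq_DstarN`) — Lemma 27.2 of mine-2's
`MINE2-RLS.md` in the kernel, the M4 of `P3-C025-seven-three-plan.md` §9 (R2). The proof composes the direct sum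
`D(S) = Σ_{j ≤ 3} C(lp, j)·Φ_{3−j}(K)` (`SevenThreeCyclic.lean`), the three types of `Φ_r(K)`
(`SevenThreeNullityTwo.lean`) counted by size (`Phi_eq_sum_sizes`), the within-class count
(`SevenThreeSeriesClasses.lean`), the cyclic count (`SevenThreeCycClasses.lean`) and the coefficient identities of
`SevenThreeStarCoeff.lean`.
-/

namespace PercRepro

namespace SevenThree

open Finset ThmH SixThree

variable {α : Type*} [DecidableEq α] {M : Matroid α} [M.Finite]

open scoped Classical in
/-- The number of `t`-subsets of `K` of dual rank one. -/
noncomputable def Wcount (M : Matroid α) [M.Finite] (K : Finset α) (t : ℕ) : ℕ :=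
  ((K.powersetCard t).filter (fun C => drk M K C = 1)).card

open scoped Classical in
/-- The number of cyclic `t`-subsets of `K` of dual rank two. -/
noncomputable def Ycount (M : Matroid α) [M.Finite] (K : Finset α) (t : ℕ) : ℕ :=
  ((K.powersetCard t).filter (fun C => drk M K C = 2 ∧ IsCyc M K C)).card

omit [DecidableEq α] in
/-- A filter on the subsets of `K` whose condition fixes the size: the fibrewise count. -/
theorem card_filter_powerset_eq_sum_sizes (K : Finset α) (P : Finset α → Prop) [DecidablePred P]
    (Q : ℕ → Prop) [DecidablePred Q] :
    (K.powerset.filter (fun C => P C ∧ Q C.card)).card =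
      ∑ t ∈ Finset.range (K.card + 1), (if Q t then ((K.powersetCard t).filter P).card else 0) := by
  rw [Finset.card_eq_sum_card_fiberwise (f := fun C => C.card) (t := Finset.range (K.card + 1))]
  · apply Finset.sum_congr rfl
    intro t _
    by_cases hQ : Q t
    · rw [if_pos hQ]
      congr 1
      ext C
      rw [Finset.mem_filter, Finset.mem_filter, Finset.mem_powerset, Finset.mem_filter, Finset.mem_powersetCard]
      constructor
      · rintro ⟨⟨hCK, hP, -⟩, hc⟩
        exact ⟨⟨hCK, hc⟩, hP⟩
      · rintro ⟨⟨hCK, hc⟩, hP⟩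
        exact ⟨⟨hCK, hP, hc ▸ hQ⟩, hc⟩
    · rw [if_neg hQ]
      apply Finset.card_eq_zero.2
      apply Finset.filter_eq_empty_iff.2
      intro C hC
      rw [Finset.mem_filter] at hC
      intro hc
      exact hQ (hc ▸ hC.2.2)
  · intro C hC
    rw [Finset.mem_coe, Finset.mem_filter, Finset.mem_powerset] at hC
    rw [Finset.mem_coe, Finset.mem_range]
    show C.card < K.card + 1
    have := Finset.card_le_card hC.1
    omega

open scoped Classical in
/-- `Φ_r(K)` by the sizes of the complements: `36·[|K| = r + 2] + 6·Σ_t [2 ≤ t ∧ |K| + 1 = r + 2 + t]·W(t) + Σ_t [|K| = r + t]·Y(t)`. -/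
theorem Phi_eq_sum_sizes {K : Finset α} (hK : K ⊆ gr M) (hK2 : nrk M K + 2 = K.card) (hcf : cyclicPart M K = K)
    (r : ℕ) :
    Phi M r K = (if K.card = r + 2 then (36 : ℚ) else 0) +
      6 * ∑ t ∈ Finset.range (K.card + 1), (if 2 ≤ t ∧ K.card + 1 = r + 2 + t then ((Wcount M K t : ℕ) : ℚ) else 0) +
      ∑ t ∈ Finset.range (K.card + 1), (if K.card = r + t then ((Ycount M K t : ℕ) : ℚ) else 0) := by
  rw [Phi_eq_three_types hK hK2 hcf r]
  congr 2
  · have h := card_filter_powerset_eq_sum_sizes K (fun C => drk M K C = 1)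
      (fun t => 2 ≤ t ∧ K.card + 1 = r + 2 + t)
    have h' : K.powerset.filter (fun C => drk M K C = 1 ∧ 2 ≤ C.card ∧ K.card + 1 = r + 2 + C.card) =
        K.powerset.filter (fun C => drk M K C = 1 ∧ (2 ≤ C.card ∧ K.card + 1 = r + 2 + C.card)) := rfl
    rw [h', h, Nat.cast_sum]
    congr 1
    apply Finset.sum_congr rfl
    intro t _
    unfold Wcount
    split_ifs <;> simp
  · have h := card_filter_powerset_eq_sum_sizes K (fun C => drk M K C = 2 ∧ IsCyc M K C)
      (fun t => K.card = r + t)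
    have h' : K.powerset.filter (fun C => drk M K C = 2 ∧ IsCyc M K C ∧ K.card = r + C.card) =
        K.powerset.filter (fun C => (drk M K C = 2 ∧ IsCyc M K C) ∧ K.card = r + C.card) := by
      congr 1
      ext C
      tauto
    rw [h', h, Nat.cast_sum]
    apply Finset.sum_congr rfl
    intro t _
    unfold Ycount
    split_ifs <;> simp

/-- The cyclic part of a finset is coloop-free: `cyclicPart (cyclicPart S) = cyclicPart S`. -/
theorem cyclicPart_cyclicPart {S : Finset α} (hS : S ⊆ gr M) : cyclicPart M (cyclicPart M S) = cyclicPart M S := by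
  apply Finset.Subset.antisymm (cyclicPart_subset M _)
  intro k hk
  exact mem_cyclicPart.2 ⟨hk, mem_closure_erase_of_mem_cyclicPart hS hk⟩

/-- The cyclic part of a nullity-two finset has nullity two. -/
theorem nrk_cyclicPart_add_two {S : Finset α} (hS : S ⊆ gr M) (hS2 : nrk M S + 2 = S.card) :
    nrk M (cyclicPart M S) + 2 = (cyclicPart M S).card := by
  have h1 := eRk_cyclicPart_add hS
  rw [← coe_nrk, ← coe_nrk] at h1
  have h1' : nrk M (cyclicPart M S) + (coloopsOf M S).card = nrk M S := by exact_mod_cast h1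
  have h2 := card_cyclicPart_add (M := M) S
  omega

open scoped Classical in
/-- `W(|K|) = 0`: the only `|K|`-subset of `K` is `K`, of dual rank two. -/
theorem Wcount_card_eq_zero {K : Finset α} (hK2 : nrk M K + 2 = K.card) : Wcount M K K.card = 0 := by
  unfold Wcount
  apply Finset.card_eq_zero.2
  apply Finset.filter_eq_empty_iff.2
  intro C hC
  rw [Finset.mem_powersetCard] at hC
  have hCK : C = K := Finset.eq_of_subset_of_card_le hC.1 (by omega)
  subst hCK
  have := nrk_sdiff_add_card_eq (M := M) C C
  rw [Finset.sdiff_self] at this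
  have h0 : nrk M (∅ : Finset α) = 0 := by
    apply nrk_eq_of_eRk
    rw [Finset.coe_empty]
    exact M.eRk_empty
  rw [h0] at this
  omega

open scoped Classical in
/-- `Y(t) = 0` for `t ≤ 2`: a cyclic set of dual rank two has at least three points. -/
theorem Ycount_eq_zero_of_le_two {K : Finset α} (hK : K ⊆ gr M) (hK2 : nrk M K + 2 = K.card)
    (hcf : cyclicPart M K = K) {t : ℕ} (ht : t ≤ 2) : Ycount M K t = 0 := by
  unfold Ycount
  apply Finset.card_eq_zero.2
  apply Finset.filter_eq_empty_iff.2
  intro C hC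
  rw [Finset.mem_powersetCard] at hC
  rintro ⟨hd, hcyc⟩
  obtain ⟨e, he, f, hf, hns⟩ := (drk_eq_two_iff hK hK2 hcf hC.1).1 hd
  have hcyce := hcyc e he
  rw [hd] at hcyce
  obtain ⟨a, ha, b, hb, hns'⟩ :=
    (drk_eq_two_iff hK hK2 hcf ((Finset.erase_subset e C).trans hC.1)).1 hcyce
  have hab : a ≠ b := fun h => hns' (Or.inl h)
  have h2 : 2 ≤ (C.erase e).card := Finset.one_lt_card.2 ⟨a, ha, b, hb, hab⟩
  have h3 := Finset.card_erase_add_one he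
  omega

/-- A list sum over a class list is the finset sum over the classes. -/
theorem list_sum_classList {K : Finset α} {L : List (Finset α)} (hL : IsClassList M K L) (f : Finset α → ℤ) :
    (L.map f).sum = ∑ N ∈ serClasses M K, f N := by
  rw [← hL.2, List.sum_toFinset f hL.1]

/-- The class sizes of a coloop-free `K` sum to `|K|`. -/
theorem sum_classList_card {K : Finset α} (hK : K ⊆ gr M) (hcf : cyclicPart M K = K) {L : List (Finset α)}
    (hL : IsClassList M K L) : (L.map Finset.card).sum = K.card := by
  rw [← List.sum_toFinset Finset.card hL.1, hL.2]
  have h2 := sum_card_serClasses hK (A := K)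
  rw [hcf] at h2
  exact h2

/-- A class is contained in `K`, so its size is at most `|K|`. -/
theorem card_le_of_mem_serClasses {K N : Finset α} (hcf : cyclicPart M K = K) (hN : N ∈ serClasses M K) :
    N.card ≤ K.card := by
  obtain ⟨e, -, rfl⟩ := mem_serClasses.1 hN
  exact Finset.card_le_card ((serClass_subset K e).trans (by rw [hcf]))

/-- The `range 4` indicator sums, cast to `ℚ`. -/
theorem coeff_cast (lp a b : ℕ) (v : ℤ)
    (h : ∑ j ∈ Finset.range 4, (Nat.choose lp j : ℤ) * (if a + j = b then 1 else 0) = v) :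
    ∑ j ∈ Finset.range 4, ((Nat.choose lp j : ℕ) : ℚ) * (if a + j = b then (1 : ℚ) else 0) = (v : ℚ) := by
  have := congrArg (Int.cast (R := ℚ)) h
  push_cast at this
  exact this

open scoped Classical in
/-- **(T2) The within-class part**: the `j`-sum of the size-`t` within counts is `6·withinSum`. -/
theorem within_part_eq {K : Finset α} (hK : K ⊆ gr M) (hK2 : nrk M K + 2 = K.card) (hcf : cyclicPart M K = K)
    {L : List (Finset α)} (hL : IsClassList M K L) (lp : ℕ) (hlp : 5 ≤ K.card + lp) :
    ∑ j ∈ Finset.range 4, ((Nat.choose lp j : ℕ) : ℚ) *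
      (6 * ∑ t ∈ Finset.range (K.card + 1),
        (if 2 ≤ t ∧ K.card + 1 = (3 - j) + 2 + t then ((Wcount M K t : ℕ) : ℚ) else 0)) =
    6 * ((StarTable.withinSum lp (K.card + lp - 5) (L.map Finset.card) : ℤ) : ℚ) := by
  -- left side: swap the sums and use `coeff_within`
  have hswap : ∑ j ∈ Finset.range 4, ((Nat.choose lp j : ℕ) : ℚ) *
      (6 * ∑ t ∈ Finset.range (K.card + 1),
        (if 2 ≤ t ∧ K.card + 1 = (3 - j) + 2 + t then ((Wcount M K t : ℕ) : ℚ) else 0)) =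
      6 * ∑ t ∈ Finset.range (K.card + 1), (if 2 ≤ t then ((Wcount M K t : ℕ) : ℚ) else 0) *
        ∑ j ∈ Finset.range 4, ((Nat.choose lp j : ℕ) : ℚ) * (if K.card + j = t + 4 then (1 : ℚ) else 0) := by
    simp only [Finset.mul_sum]
    rw [Finset.sum_comm]
    apply Finset.sum_congr rfl
    intro t _
    apply Finset.sum_congr rfl
    intro j hj
    rw [Finset.mem_range] at hj
    by_cases h2 : 2 ≤ t
    · by_cases heq : K.card + j = t + 4
      · rw [if_pos ⟨h2, by omega⟩, if_pos h2, if_pos heq]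
        ring
      · rw [if_neg (fun hh => heq (by omega)), if_pos h2, if_neg heq]
        ring
    · rw [if_neg (fun hh => h2 hh.1), if_neg h2]
      ring
  rw [hswap]
  -- right side: `withinSum` as a double sum over the classes
  rw [StarCoeff.withinSum_eq, List.map_map, list_sum_classList hL]
  have hnu : K.card + lp - 5 + 1 = K.card + lp - 4 := by omega
  simp only [Function.comp_apply, hnu]
  push_cast
  congr 1
  -- extend the inner ranges to `range (|K| + 1)` and swap
  have hext : ∀ N ∈ serClasses M K, ∑ j ∈ Finset.range (N.card + 1),
      (if 2 ≤ j then ((Nat.choose N.card j : ℕ) : ℚ) * ((StarTable.chooseSub lp (K.card + lp - 4) j : ℤ) : ℚ) else 0) =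
      ∑ j ∈ Finset.range (K.card + 1),
      (if 2 ≤ j then ((Nat.choose N.card j : ℕ) : ℚ) * ((StarTable.chooseSub lp (K.card + lp - 4) j : ℤ) : ℚ) else 0) := by
    intro N hN
    apply Finset.sum_subset (Finset.range_mono (by have := card_le_of_mem_serClasses hcf hN; omega))
    intro j hj hj'
    rw [Finset.mem_range] at hj hj'
    rw [Nat.choose_eq_zero_of_lt (by omega : N.card < j)]
    simp
  rw [Finset.sum_congr rfl hext, Finset.sum_comm]
  apply Finset.sum_congr rfl
  intro t ht
  rw [Finset.mem_range] at ht
  by_cases h2 : 2 ≤ t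
  · simp only [if_pos h2]
    rw [← Finset.sum_mul]
    by_cases htm : t < K.card
    · rw [coeff_cast lp K.card (t + 4) _ (StarCoeff.coeff_within lp K.card t (by omega) htm)]
      unfold Wcount
      rw [card_filter_drk_one hK hcf (by omega : 1 ≤ t), Nat.cast_sum]
    · have htK : t = K.card := by omega
      rw [htK, Wcount_card_eq_zero hK2]
      have hzero : ∑ N ∈ serClasses M K, ((Nat.choose N.card K.card : ℕ) : ℚ) = 0 := by
        apply Finset.sum_eq_zero
        intro N hN
        obtain ⟨e, he, rfl⟩ := mem_serClasses.1 hN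
        have hsub : serClass M K e ⊆ K := (serClass_subset K e).trans (by rw [hcf])
        have hne : serClass M K e ≠ K := by
          intro heq
          have h1 := drk_eq_one_of_subset_serClass hK hN (Finset.Subset.refl _) (nonempty_of_mem_serClasses hN)
          rw [heq] at h1
          have h2 := nrk_sdiff_add_card_eq (M := M) K K
          rw [Finset.sdiff_self] at h2
          have h0 : nrk M (∅ : Finset α) = 0 := by
            apply nrk_eq_of_eRk
            rw [Finset.coe_empty]
            exact M.eRk_empty
          rw [h0, h1] at h2
          omega
        rw [Nat.choose_eq_zero_of_lt (Finset.card_lt_card (Finset.ssubset_iff_subset_ne.2 ⟨hsub, hne⟩))]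
        simp
      rw [hzero]
      simp
  · simp [h2]

open scoped Classical in
/-- **(T3) The cyclic part**: the `j`-sum of the size-`t` cyclic counts is the table's `cyc` sum. -/
theorem cyc_part_eq {K : Finset α} (hK : K ⊆ gr M) (hK2 : nrk M K + 2 = K.card) (hcf : cyclicPart M K = K)
    {L : List (Finset α)} (hL : IsClassList M K L) (lp : ℕ) (hlp : 5 ≤ K.card + lp) :
    ∑ j ∈ Finset.range 4, ((Nat.choose lp j : ℕ) : ℚ) *
      ∑ t ∈ Finset.range (K.card + 1), (if K.card = (3 - j) + t then ((Ycount M K t : ℕ) : ℚ) else 0) =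
    ((StarTable.sumTo (L.map Finset.card).sum (fun j => if 3 ≤ j then
      (StarTable.cyc (L.map Finset.card) j : ℤ) * StarTable.chooseSub lp (K.card + lp - 5 + 2) j else 0) : ℤ) : ℚ) := by
  have hswap : ∑ j ∈ Finset.range 4, ((Nat.choose lp j : ℕ) : ℚ) *
      ∑ t ∈ Finset.range (K.card + 1), (if K.card = (3 - j) + t then ((Ycount M K t : ℕ) : ℚ) else 0) =
      ∑ t ∈ Finset.range (K.card + 1), ((Ycount M K t : ℕ) : ℚ) *
        ∑ j ∈ Finset.range 4, ((Nat.choose lp j : ℕ) : ℚ) * (if K.card + j = t + 3 then (1 : ℚ) else 0) := by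
    simp_rw [Finset.mul_sum]
    rw [Finset.sum_comm]
    apply Finset.sum_congr rfl
    intro t _
    apply Finset.sum_congr rfl
    intro j hj
    rw [Finset.mem_range] at hj
    by_cases heq : K.card + j = t + 3
    · rw [if_pos (by omega), if_pos heq]
      ring
    · rw [if_neg (fun hh => heq (by omega)), if_neg heq]
      ring
  rw [hswap, StarCoeff.sumTo_eq_sum, sum_classList_card hK hcf hL]
  have hx : K.card + lp - 5 + 2 = K.card + lp - 3 := by omega
  rw [hx]
  push_cast
  apply Finset.sum_congr rfl
  intro t ht
  rw [Finset.mem_range] at ht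
  rw [coeff_cast lp K.card (t + 3) _ (StarCoeff.coeff_cyc lp K.card t (by omega) (by omega))]
  rw [cyc_eq_card_filter hK hK2 hcf hL t]
  by_cases h3 : 3 ≤ t
  · rw [if_pos h3]
    unfold Ycount
    ring
  · rw [if_neg h3]
    have := Ycount_eq_zero_of_le_two hK hK2 hcf (by omega : t ≤ 2)
    rw [this]
    simp

/-- **(T1) The top part**. -/
theorem top_part_eq (lp m : ℕ) (hlp : 5 ≤ m + lp) (hm2 : 2 ≤ m) :
    ∑ j ∈ Finset.range 4, ((Nat.choose lp j : ℕ) : ℚ) * (if m = (3 - j) + 2 then (36 : ℚ) else 0) =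
      36 * ((Nat.choose lp (m + lp - 5) : ℕ) : ℚ) := by
  have h := coeff_cast lp m 5 _ (StarCoeff.coeff_top lp m hlp hm2)
  push_cast at h
  rw [← h, Finset.mul_sum]
  apply Finset.sum_congr rfl
  intro j hj
  rw [Finset.mem_range] at hj
  by_cases heq : m + j = 5
  · rw [if_pos (by omega), if_pos heq]
    ring
  · rw [if_neg (fun hh => heq (by omega)), if_neg heq]
    ring

open scoped Classical in
/-- **THEOREM (Lemma 27.2 in the kernel)**: for a nullity-two finset `S ⊆ E` with at least `5` points, the denominator
`D(S)` is the star table's `DstarN lp cs x` with `lp` the number of coloops of `S`, `cs` the sizes of the series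
classes of its cyclic part (in the order of any class list `L`) and `x = |S| − 3`. -/
theorem D_eq_DstarN {S : Finset α} (hS : S ⊆ gr M) (hS2 : nrk M S + 2 = S.card) (hS5 : 5 ≤ S.card)
    {L : List (Finset α)} (hL : IsClassList M (cyclicPart M S) L) :
    D M S = ((StarTable.DstarN (coloopsOf M S).card (L.map Finset.card) (S.card - 3) : ℤ) : ℚ) := by
  have hK : cyclicPart M S ⊆ gr M := (cyclicPart_subset M S).trans hS
  have hK2 := nrk_cyclicPart_add_two hS hS2
  have hcf := cyclicPart_cyclicPart hS
  have hcard := card_cyclicPart_add (M := M) S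
  set K := cyclicPart M S with hKdef
  set lp := (coloopsOf M S).card with hlpdef
  have hlp : 5 ≤ K.card + lp := by omega
  have hm2 : 2 ≤ K.card := by omega
  have hx2 : S.card - 3 - 2 = K.card + lp - 5 := by omega
  rw [D_eq_sum_cyclicPart hS, ← hKdef, ← hlpdef]
  unfold StarTable.DstarN
  rw [hx2]
  push_cast
  rw [Finset.sum_congr rfl (fun j _ => by rw [Phi_eq_sum_sizes hK hK2 hcf (3 - j)])]
  simp_rw [mul_add]
  rw [Finset.sum_add_distrib, Finset.sum_add_distrib, top_part_eq lp K.card hlp hm2,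
    within_part_eq hK hK2 hcf hL lp hlp, cyc_part_eq hK hK2 hcf hL lp hlp]

end SevenThree

end PercRepro
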